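import Mathlib.RingTheory.Ideal.Quotient.Operations
import Mathlib.RingTheory.LocalRing.RingHom.Basic
import Literature.AlgebraicGeometry.Resolution.RegularLocalRingsQuotient
import Literature.AlgebraicGeometry.Resolution.CohenMacaulaySystemsOfParameters
import Literature.AlgebraicGeometry.Resolution.CohenMacaulayLocalization
import HarnessLib

/-!
# `EquisingularLiftNat` — helper: Böckle-type flatness from the expected special dimension
# (a family cutting the dimension of a regular local ring down by its length is a regular sequence)

[OURS · L1 W4.5(b)] Support lemma for the crux `EquisingularLiftNat` (stmt-ResolutionOfSingularities-20038;
`Summit.ResolutionOfSingularities.ResolutionOfSingularities.Theses.EquisingularLift.EquisingularLiftNat`), answering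
res-L1-w45b-idea-2's ASK ×3 (B) of 2026-08-27T06:26:09Z: the hinge `BoeckleFlatOfExpectedDim` of idea card 8
`expected-dimension-lifts` (HOME `L/res-L1-w45b-idea-2/Sketch-L1-idea-2.lean` v5, l.393 — there with `sorry`) is proved
here VERBATIM as `boeckleFlatOfExpectedDim`. NOT a statement of any manuscript under review; AI-written kernel lemmas of
the cell `res-hironaka` (weaker than expert review). Typed by res-type-018. No definition is declared.

CONTENT (pure commutative algebra).

* `exists_radical_span_eq_maximalIdeal_of_ringKrullDim_le` — a Noetherian local ring of dimension `≤ n` has `n`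
  elements of `𝔪` generating an `𝔪`-primary ideal (a system of parameters padded with zeros).
* `exists_radical_sup_span_eq_maximalIdeal_of_ringKrullDim_quotient_le` — if `J ⊆ 𝔪` and `dim S/J ≤ n`, then `J`
  becomes `𝔪`-primary after adding `n` elements of `𝔪` (lift the previous family from `S/J`).
* `isWeaklyRegular_ofFn_of_ringKrullDim_quotient_le` — **Bruns–Herzog 2.1.2 (c) ⇒ (d) for the tree's Cohen–Macaulay
  phrasing**: in a Noetherian local ring `S` with an `S`-regular sequence in `𝔪` of length `dim S = r + e`, a family
  `g : Fin r → S` of elements of `𝔪` with `dim S/(g) ≤ e` extends to a system of parameters, hence (Matsumura 17.4 (iii),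
  `Literature.AlgebraicGeometry.Resolution.cmClause_of_exists_isRegular`) is a weakly regular sequence; the regular local
  case `isWeaklyRegular_ofFn_of_ringKrullDim_quotient_le_of_isRegularLocalRing` (Matsumura 17.8).
* `boeckleFlatOfExpectedDim` — the card's statement: `S` regular local of dimension `h + 1`, `ϖ ∈ 𝔪`,
  `f : Fin o → 𝔪`, `o ≤ h`, `dim S/((f) + (ϖ)) ≤ h − o` ⟹ `ϖ` is a non-zero-divisor on `S/(f)` (the sequence
  `f₁, …, f_o, ϖ` has `o + 1` members and cuts `dim S = h + 1` down to `≤ h − o`, so it is weakly regular and its last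
  member is regular on `S/(f)`); `mk_mem_nonZeroDivisors_of_ringKrullDim_quotient_le` is the same in `nonZeroDivisors` dress.

Reading (card 8): `S = W⟦t₁,…,t_h⟧`, `ϖ = p`, `I = (f₁,…,f_o)` the `≤ h¹(N_X)` obstruction relations of
`𝒪^_{Hilb(ℙ³_W),[X]}`; expected special dimension forces flatness over `W` (Böckle, «Presentations of universal deformation
rings», Lemma 0.1 / Remark 1.3, transplanted; de Jong 1996). References for the algebra: [Matsumura1987] Thm. 17.4 (iii),
17.8; [BrunsHerzog1998] Thm. 2.1.2. Kernel-only (propext, Classical.choice, Quot.sound).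
-/

-- single-problem summit: the doubled namespace component `ResolutionOfSingularities` is forced
set_option linter.dupNamespace false

namespace Summit.ResolutionOfSingularities.ResolutionOfSingularities.Theorems.EquisingularLift.ExpectedDimension

open IsLocalRing RingTheory.Sequence Literature.RingTheory.TightClosure Literature.AlgebraicGeometry.Resolution

universe u

section LocalNoetherian

variable {A : Type u} [CommRing A] [IsLocalRing A] [IsNoetherianRing A]

/-- **An `𝔪`-primary ideal with `n ≥ dim A` generators.** A Noetherian local ring `A` with `dim A ≤ n` has a family
`u : Fin n → A` of elements of `𝔪` with `rad (u) = 𝔪` (a system of parameters, padded with zeros). [folklore] -/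
theorem exists_radical_span_eq_maximalIdeal_of_ringKrullDim_le {n : ℕ}
    (hn : ringKrullDim A ≤ (n : WithBot ℕ∞)) :
    ∃ u : Fin n → A, (∀ i, u i ∈ maximalIdeal A) ∧
      (Ideal.span (Set.range u)).radical = maximalIdeal A := by
  obtain ⟨d, hd⟩ := exists_nat_cast_eq_ringKrullDim (R := A)
  have hdn : d ≤ n := by
    rw [hd] at hn
    exact_mod_cast hn
  obtain ⟨e, rfl⟩ := Nat.exists_eq_add_of_le hdn
  obtain ⟨s, hs⟩ := exists_isSystemOfParameters (R := A) hd
  have hsm : ∀ i, s i ∈ maximalIdeal A := fun i => by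
    rw [← hs.2]
    exact Ideal.le_radical (Ideal.subset_span ⟨i, rfl⟩)
  refine ⟨Fin.append s (fun _ => 0), fun i => ?_, le_antisymm ?_ ?_⟩
  · refine Fin.addCases (fun j => ?_) (fun j => ?_) i
    · rw [Fin.append_left]
      exact hsm j
    · rw [Fin.append_right]
      exact zero_mem _
  · refine ((maximalIdeal.isMaximal A).isPrime.radical_le_iff).mpr (Ideal.span_le.mpr ?_)
    rintro _ ⟨i, rfl⟩
    refine Fin.addCases (fun j => ?_) (fun j => ?_) i
    · rw [Fin.append_left]
      exact hsm j
    · rw [Fin.append_right]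
      exact zero_mem _
  · rw [← hs.2]
    refine Ideal.radical_mono (Ideal.span_mono ?_)
    rintro _ ⟨j, rfl⟩
    exact ⟨Fin.castAdd e j, Fin.append_left s _ j⟩

end LocalNoetherian

section Lift

variable {S : Type u} [CommRing S] [IsLocalRing S] [IsNoetherianRing S]

/-- **Completing a proper ideal to an `𝔪`-primary one with `dim S/J` more elements.** If `J ⊆ 𝔪` and
`dim S/J ≤ n`, there are `t₁, …, t_n ∈ 𝔪` with `rad (J + (t)) = 𝔪` (lift an `𝔪̄`-primary family of `S/J`).
[folklore] -/
theorem exists_radical_sup_span_eq_maximalIdeal_of_ringKrullDim_quotient_le (J : Ideal S)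
    (hJ : J ≤ maximalIdeal S) {n : ℕ} (hn : ringKrullDim (S ⧸ J) ≤ (n : WithBot ℕ∞)) :
    ∃ t : Fin n → S, (∀ i, t i ∈ maximalIdeal S) ∧
      (J ⊔ Ideal.span (Set.range t)).radical = maximalIdeal S := by
  have hJtop : J ≠ ⊤ := fun h => (maximalIdeal.isMaximal S).ne_top (top_le_iff.mp (h ▸ hJ))
  haveI : Nontrivial (S ⧸ J) := Ideal.Quotient.nontrivial_iff.mpr hJtop
  haveI : IsLocalRing (S ⧸ J) := isLocalRing_quotient hJtop
  obtain ⟨u, hum, hu⟩ := exists_radical_span_eq_maximalIdeal_of_ringKrullDim_le (A := S ⧸ J) hn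
  choose t ht using fun i => Ideal.Quotient.mk_surjective (u i)
  have hmk : maximalIdeal (S ⧸ J) = (maximalIdeal S).map (Ideal.Quotient.mk J) :=
    (map_maximalIdeal_of_surjective _ Ideal.Quotient.mk_surjective).symm
  have hut : u = ⇑(Ideal.Quotient.mk J) ∘ t := funext fun i => (ht i).symm
  -- the lifts are non-units
  have htm : ∀ i, t i ∈ maximalIdeal S := fun i => by
    rw [mem_maximalIdeal, mem_nonunits_iff]
    intro h
    have h' : IsUnit (u i) := by
      rw [← ht i]
      exact h.map _
    exact (mem_maximalIdeal _ |>.mp (hum i)) h'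
  refine ⟨t, htm, le_antisymm ?_ fun m hm => ?_⟩
  · exact ((maximalIdeal.isMaximal S).isPrime.radical_le_iff).mpr
      (sup_le hJ (Ideal.span_le.mpr (Set.range_subset_iff.mpr htm)))
  · -- `m̄ ∈ 𝔪̄ = rad (ū)`, so `m̄ᵏ ∈ (ū) = (t) S/J`, i.e. `mᵏ ∈ J + (t)`
    have hm' : Ideal.Quotient.mk J m ∈ (Ideal.span (Set.range u)).radical := by
      rw [hu, hmk]
      exact Ideal.mem_map_of_mem _ hm
    obtain ⟨k, hk⟩ := hm'
    rw [hut, Set.range_comp, ← Ideal.map_span, ← map_pow] at hk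
    have hk' : m ^ k ∈ Ideal.comap (Ideal.Quotient.mk J)
        (Ideal.map (Ideal.Quotient.mk J) (J ⊔ Ideal.span (Set.range t))) :=
      Ideal.mem_comap.mpr (Ideal.map_mono le_sup_right hk)
    rw [Ideal.comap_map_mk le_sup_left] at hk'
    exact ⟨k, hk'⟩

end Lift

section CohenMacaulay

variable {S : Type u} [CommRing S] [IsNoetherianRing S] [IsLocalRing S]

/-- **A family cutting the dimension down by its length is weakly regular (Cohen–Macaulay local rings).** Let `S` be a
Noetherian local ring with an `S`-regular sequence in `𝔪` of length `dim S = r + e` (the tree's phrasing of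
«Cohen–Macaulay»). If `g : Fin r → S` consists of elements of `𝔪` and `dim S/(g) ≤ e`, then `g` extends to a system of
parameters of `S` and is therefore a weakly regular sequence on `S`, in the given order.
[cite: BrunsHerzog1998, Thm. 2.1.2 (c) ⇒ (d); Matsumura1987, Thm. 17.4 (iii)] -/
theorem isWeaklyRegular_ofFn_of_ringKrullDim_quotient_le
    (hCM : ∃ rs : List S, IsRegular S rs ∧ (∀ r ∈ rs, r ∈ maximalIdeal S) ∧
      (rs.length : WithBot ℕ∞) = ringKrullDim S)
    {r e : ℕ} (hdim : ringKrullDim S = ((r + e : ℕ) : WithBot ℕ∞)) (g : Fin r → S)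
    (hg : ∀ i, g i ∈ maximalIdeal S)
    (hq : ringKrullDim (S ⧸ Ideal.span (Set.range g)) ≤ (e : WithBot ℕ∞)) :
    IsWeaklyRegular S (List.ofFn g) := by
  have hJ : Ideal.span (Set.range g) ≤ maximalIdeal S :=
    Ideal.span_le.mpr (Set.range_subset_iff.mpr hg)
  obtain ⟨t, -, hrad⟩ :=
    exists_radical_sup_span_eq_maximalIdeal_of_ringKrullDim_quotient_le (Ideal.span (Set.range g)) hJ hq
  -- `(g, t)` is a system of parameters, hence weakly regular; its head `g` is weakly regular
  -- the range of an appended family (`range_fin_append` of `AlterationsEnlargingZ.lean`, re-proved inline to keep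
  -- the imports small)
  have hra : Set.range (Fin.append g t) = Set.range g ∪ Set.range t := by
    have hc : Fin.append g t ∘ ⇑finSumFinEquiv = Sum.elim g t := Fin.append_comp_sumElim
    rw [← EquivLike.range_comp (Fin.append g t) finSumFinEquiv, hc, Set.Sum.elim_range]
  have hsop : (Ideal.span (Set.range (Fin.append g t))).radical.IsMaximal := by
    rw [hra, Ideal.span_union, hrad]
    exact maximalIdeal.isMaximal S
  exact isWeaklyRegular_ofFn_of_isWeaklyRegular_ofFn_append g t
    (cmClause_of_exists_isRegular hCM (r + e) hdim (Fin.append g t) hsop)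

/-- **Regular local case** of `isWeaklyRegular_ofFn_of_ringKrullDim_quotient_le` (regular ⇒ Cohen–Macaulay,
Matsumura 17.8): in a regular local ring of dimension `r + e`, elements `g₁, …, g_r ∈ 𝔪` with `dim S/(g) ≤ e` form a
weakly regular sequence. [cite: Matsumura1987, Thm. 17.8, 17.4 (iii)] -/
theorem isWeaklyRegular_ofFn_of_ringKrullDim_quotient_le_of_isRegularLocalRing {S : Type u} [CommRing S]
    [IsRegularLocalRing S] {r e : ℕ} (hdim : ringKrullDim S = ((r + e : ℕ) : WithBot ℕ∞)) (g : Fin r → S)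
    (hg : ∀ i, g i ∈ maximalIdeal S)
    (hq : ringKrullDim (S ⧸ Ideal.span (Set.range g)) ≤ (e : WithBot ℕ∞)) :
    IsWeaklyRegular S (List.ofFn g) := by
  obtain ⟨rs, hrs, hmem, hlen⟩ := exists_isRegular_length_eq_ringKrullDim S
  exact isWeaklyRegular_ofFn_of_ringKrullDim_quotient_le ⟨rs, hrs, hmem, hlen⟩ hdim g hg hq

end CohenMacaulay

section Boeckle

/-- The submodule `(f) • S` cut out by the head of a sequence is the ideal `(f)`. [folklore] -/
theorem ofList_ofFn_smul_top {S : Type u} [CommRing S] {o : ℕ} (f : Fin o → S) :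
    (Ideal.ofList (List.ofFn f) • ⊤ : Submodule S S) = Ideal.span (Set.range f) := by
  rw [Ideal.smul_eq_mul, Ideal.mul_top]
  exact congrArg Ideal.span (Set.ext fun r => List.mem_ofFn' f r)

/-- **The last member of a dimension-cutting family is regular modulo the others.** `S` regular local of dimension
`h + 1`, `ϖ ∈ 𝔪`, `f : Fin o → 𝔪` with `o ≤ h`; if `dim S/((f) + (ϖ)) ≤ h − o` then `ϖ` is an `S/(f)`-regular
scalar (the `o + 1` elements `f₁, …, f_o, ϖ` cut `dim S = h + 1` down to `≤ h − o`, so they form a weakly regular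
sequence by `isWeaklyRegular_ofFn_of_ringKrullDim_quotient_le_of_isRegularLocalRing`).
[cite: BrunsHerzog1998, Thm. 2.1.2; Matsumura1987, Thm. 17.4 (iii), 17.8] -/
theorem isSMulRegular_quotient_of_ringKrullDim_quotient_le {S : Type u} [CommRing S] [IsRegularLocalRing S]
    {h o : ℕ} (ho : o ≤ h) (hdim : ringKrullDim S = ((h + 1 : ℕ) : WithBot ℕ∞)) {ϖ : S} {f : Fin o → S}
    (hϖ : ϖ ∈ maximalIdeal S) (hf : ∀ i, f i ∈ maximalIdeal S)
    (hq : ringKrullDim (S ⧸ (Ideal.span (Set.range f) ⊔ Ideal.span {ϖ})) ≤ ((h - o : ℕ) : WithBot ℕ∞)) :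
    IsSMulRegular (S ⧸ Ideal.span (Set.range f)) ϖ := by
  -- the family `(f, ϖ) : Fin (o + 1) → S`
  set g : Fin (o + 1) → S := Fin.append f (fun _ : Fin 1 => ϖ) with hg_def
  have hgm : ∀ i, g i ∈ maximalIdeal S := fun i => by
    refine Fin.addCases (fun j => ?_) (fun j => ?_) i
    · rw [hg_def, Fin.append_left]
      exact hf j
    · rw [hg_def, Fin.append_right]
      exact hϖ
  have hra : Set.range g = Set.range f ∪ Set.range (fun _ : Fin 1 => ϖ) := by
    have hc : Fin.append f (fun _ : Fin 1 => ϖ) ∘ ⇑finSumFinEquiv = Sum.elim f (fun _ : Fin 1 => ϖ) :=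
      Fin.append_comp_sumElim
    rw [hg_def, ← EquivLike.range_comp (Fin.append f _) finSumFinEquiv, hc, Set.Sum.elim_range]
  have hspan : Ideal.span (Set.range g) = Ideal.span (Set.range f) ⊔ Ideal.span {ϖ} := by
    rw [hra, Ideal.span_union, Set.range_const]
  have hdim' : ringKrullDim S = ((o + 1 + (h - o) : ℕ) : WithBot ℕ∞) := by
    rw [hdim, show o + 1 + (h - o) = h + 1 by omega]
  have hq' : ringKrullDim (S ⧸ Ideal.span (Set.range g)) ≤ ((h - o : ℕ) : WithBot ℕ∞) := by
    rw [hspan]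
    exact hq
  have hreg := isWeaklyRegular_ofFn_of_ringKrullDim_quotient_le_of_isRegularLocalRing hdim' g hgm hq'
  rw [hg_def, List.ofFn_fin_append, isWeaklyRegular_append_iff] at hreg
  have h1 : IsWeaklyRegular (S ⧸ (Ideal.ofList (List.ofFn f) • ⊤ : Submodule S S)) [ϖ] := by
    simpa [List.ofFn_succ] using hreg.2
  rw [isWeaklyRegular_singleton_iff, ofList_ofFn_smul_top] at h1
  exact h1

/-- **`BoeckleFlatOfExpectedDim` (idea card 8 `expected-dimension-lifts`, step (a)) — VERBATIM.** `S` regular local of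
dimension `h + 1` (read `W⟦t₁,…,t_h⟧`), `ϖ ∈ 𝔪_S` (read `p`), `I = (f₁,…,f_o) ⊆ 𝔪_S` with `o ≤ h` (read: the
`≤ h¹(N_X)` obstruction relations). If the special fibre `S/(I + (ϖ))` has Krull dimension `≤ h − o` (the EXPECTED
dimension), then `ϖ` is a non-zero-divisor on `S/I`: the `W`-deformation ring is flat over `W`. [Proof: `f₁,…,f_o, ϖ` cut
`dim S = h + 1` down to `≤ h − o = dim S − (o + 1)`, so they extend to a system of parameters of the regular, hence
Cohen–Macaulay, local ring `S` and form a regular sequence (Matsumura 17.8, 17.4 (iii)); in particular `ϖ` is regular on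
`S/(f)`.] Transplant of Böckle, «Presentations of universal deformation rings», Lemma 0.1 / Remark 1.3, with de Jong's
observation (1996). [cite: BrunsHerzog1998, Thm. 2.1.2; Matsumura1987, Thm. 17.4 (iii), 17.8] -/
theorem boeckleFlatOfExpectedDim :
    ∀ (S : Type) [CommRing S] [IsRegularLocalRing S] (h o : ℕ), o ≤ h → ringKrullDim S = ((h + 1 : ℕ) : WithBot ℕ∞) →
    ∀ (ϖ : S) (f : Fin o → S), ϖ ∈ maximalIdeal S → (∀ i, f i ∈ maximalIdeal S) →
    ringKrullDim (S ⧸ (Ideal.span (Set.range f) ⊔ Ideal.span {ϖ})) ≤ ((h - o : ℕ) : WithBot ℕ∞) →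
    ∀ r : S ⧸ Ideal.span (Set.range f), Ideal.Quotient.mk (Ideal.span (Set.range f)) ϖ * r = 0 → r = 0 := by
  intro S _ _ h o ho hdim ϖ f hϖ hf hq r hr
  have hreg := isSMulRegular_quotient_of_ringKrullDim_quotient_le ho hdim hϖ hf hq
  refine hreg (?_ : ϖ • r = ϖ • (0 : S ⧸ Ideal.span (Set.range f)))
  rw [smul_zero, Algebra.smul_def, Ideal.Quotient.algebraMap_eq, hr]

/-- `BoeckleFlatOfExpectedDim` in `nonZeroDivisors` dress: under the same hypotheses the class of `ϖ` is a
non-zero-divisor of `S/(f)`. [cite: BrunsHerzog1998, Thm. 2.1.2; Matsumura1987, Thm. 17.4 (iii), 17.8] -/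
theorem mk_mem_nonZeroDivisors_of_ringKrullDim_quotient_le {S : Type u} [CommRing S] [IsRegularLocalRing S]
    {h o : ℕ} (ho : o ≤ h) (hdim : ringKrullDim S = ((h + 1 : ℕ) : WithBot ℕ∞)) {ϖ : S} {f : Fin o → S}
    (hϖ : ϖ ∈ maximalIdeal S) (hf : ∀ i, f i ∈ maximalIdeal S)
    (hq : ringKrullDim (S ⧸ (Ideal.span (Set.range f) ⊔ Ideal.span {ϖ})) ≤ ((h - o : ℕ) : WithBot ℕ∞)) :
    Ideal.Quotient.mk (Ideal.span (Set.range f)) ϖ ∈ nonZeroDivisors (S ⧸ Ideal.span (Set.range f)) := by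
  have hreg := isSMulRegular_quotient_of_ringKrullDim_quotient_le ho hdim hϖ hf hq
  refine mem_nonZeroDivisors_iff_right.mpr fun r hr => hreg (?_ : ϖ • r = ϖ • (0 : S ⧸ Ideal.span (Set.range f)))
  rw [smul_zero, Algebra.smul_def, Ideal.Quotient.algebraMap_eq, mul_comm, hr]

end Boeckle

end Summit.ResolutionOfSingularities.ResolutionOfSingularities.Theorems.EquisingularLift.ExpectedDimension
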